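import Summits.Langlands.Langlands.Theorems.PotentialCompanionDescentBrauerTaylorDescentCompanionTransport
import Summits.Langlands.Langlands.Theorems.PotentialCompanionDescentBrauerTaylorDescentFrobeniusRigidity
import Literature.RepresentationTheory.FiniteGroups.VirtualBrauerDescent
import Literature.RepresentationTheory.Semisimple.RelativeMaschke
import Literature.RepresentationTheory.Semisimple.SubrepresentationEquiv
import HarnessLib

/-!
# Brauer–Taylor descent for `PotentialCompanionDescent.BrauerTaylorDescent` — companion rigidity

Part 2c of the lineage programme (Barnet-Lamb–Gee–Geraghty–Taylor 2014, Thm. 5.5.1): the two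
representation-theoretic inputs `hr` and `hiso` of virtual Brauer descent
(`Literature.RepresentationTheory.FiniteGroups.Representation.exists_irreducible_virtualBrauerDescent`)
for the transported companions `rᵢ = σᵢ ∘ tᵢ` (`tᵢ : Hᵢ → Γ_{Eᵢ}` a transport,
`…CompanionTransport`), obtained from the Frobenius-rigidity engine of `…FrobeniusRigidity`:

* `character_eq_of_companions` — two transported companions of the same `ρ`, pulled back to a
  group `D` openly embedded in `Γ_K` along maps covering `d ↦ g d g⁻¹` and `d ↦ d`, have the same
  character (they agree at the Frobenii of `K` outside a finite set: `charpoly ρ(g d g⁻¹) =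
  charpoly ρ(d)` pins down one Satake parameter, `charpoly_transportRep_eq_of_companion`);
* `isIrreducible_comp_inclusion_of_companions` (**hr**) — if `σ` is semisimple and the companion
  `σ_L` over the normal layer `L` (`res(Γ_L) = N ≤ H`) is irreducible, then `rᵢ|_N` is irreducible
  (Clifford + relative Maschke make `rᵢ|_N` semisimple; Brauer–Nesbitt identifies it with the
  transport of `σ_L`);
* `nonempty_equiv_mackeyConjRep_of_companions` (**hiso**) — `rᵢ^g ≅ rⱼ` on Mackey's subgroup
  `Hⱼ ∩ g⁻¹Hᵢg`, for all `g ∈ Γ_K`.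

References: Barnet-Lamb–Gee–Geraghty–Taylor, Ann. of Math. 179 (2014), proof of Thm. 5.5.1;
Serre, *Abelian ℓ-adic representations*, Ch. I §2.3; Curtis–Reiner I §11 (Clifford).
-/

set_option linter.dupNamespace false

noncomputable section

open Field IsDedekindDomain NumberField Polynomial Topology
open Literature.NumberTheory.GaloisRepresentations Literature.NumberTheory.Automorphic
open Literature.RepresentationTheory Literature.RepresentationTheory.FiniteGroups
open Literature.RepresentationTheory.Semisimple
open scoped NumberField Pointwise

namespace Summit.Langlands.Langlands.Theorems.BrauerTaylorDescent

/-! ### Rigidity of transported companions -/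

section Rigidity

variable {K : Type} [Field K] [NumberField K] {n : ℕ} {ℓ : ℕ} [Fact ℓ.Prime]
  (ι : PadicAlgCl ℓ ≃+* ℂ) (ι₂ : PadicAlgCl 2 ≃+* ℂ) (ρ : FramedGaloisRep K (PadicAlgCl ℓ) n)
  {E : Type} [Field E] [NumberField E] [Algebra K E]
  {H : Subgroup (absoluteGaloisGroup K)} {c : absoluteGaloisGroup K}
  (t : H →ₜ* absoluteGaloisGroup E) (ht : ∀ h : H, absGaloisRestrict K E (t h) = c * h * c⁻¹)
  (σ : FramedGaloisRep E (PadicAlgCl 2) n)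
  (hmatch : ∀ᶠ w : HeightOneSpectrum (𝓞 E) in Filter.cofinite, ∃ α : Multiset ℂ,
    (ρ.restrictField E).HasFrobCharpolyAt w (arithFrobPolyOfSatake ι w.residueCard 1 α) ∧
    σ.HasFrobCharpolyAt w (arithFrobPolyOfSatake ι₂ w.residueCard 1 α))
  {E' : Type} [Field E'] [NumberField E'] [Algebra K E']
  {H' : Subgroup (absoluteGaloisGroup K)} {c' : absoluteGaloisGroup K}
  (t' : H' →ₜ* absoluteGaloisGroup E')
  (ht' : ∀ h : H', absGaloisRestrict K E' (t' h) = c' * h * c'⁻¹)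
  (σ' : FramedGaloisRep E' (PadicAlgCl 2) n)
  (hmatch' : ∀ᶠ w : HeightOneSpectrum (𝓞 E') in Filter.cofinite, ∃ α : Multiset ℂ,
    (ρ.restrictField E').HasFrobCharpolyAt w (arithFrobPolyOfSatake ι w.residueCard 1 α) ∧
    σ'.HasFrobCharpolyAt w (arithFrobPolyOfSatake ι₂ w.residueCard 1 α))

include ht ht' hmatch hmatch' in
/-- **Transported companions have equal characters on a common open subgroup.**  Let `D` be
openly embedded in `Γ_K` by `e`, and `f : D → H`, `f' : D → H'` continuous homomorphisms with
`f(d) = g e(d) g⁻¹` and `f'(d) = e(d)` in `Γ_K`.  Then `rᵢ ∘ f` and `rⱼ ∘ f'` have the same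
character: at `d` with `e(d)` an arithmetic Frobenius above a good place `v`, both characteristic
polynomials are the `ι₂`-Frobenius polynomial of the Satake parameter of `charpoly ρ(e d)`
(`charpoly_transportRep_eq_of_companion`), and such `d` are dense (`character_eq_of_eqOn_frobenius`).
BLGGT 2014, proof of Thm. 5.5.1. [folklore] -/
theorem character_eq_of_companions {D : Type} [Group D] [TopologicalSpace D]
    (e : D → absoluteGaloisGroup K) (he : IsOpenEmbedding e)
    (f : D →* H) (hf : Continuous f) (g : absoluteGaloisGroup K)
    (hfe : ∀ d, (f d : absoluteGaloisGroup K) = g * e d * g⁻¹)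
    (f' : D →* H') (hf' : Continuous f') (hfe' : ∀ d, (f' d : absoluteGaloisGroup K) = e d) :
    Representation.character ((FramedRep.toRepresentation (σ.comp t)).comp f) =
      Representation.character ((FramedRep.toRepresentation (σ'.comp t')).comp f') := by
  have hev := (eventually_forall_under (K := K) hmatch).and (eventually_forall_under (K := K) hmatch')
  refine character_eq_of_eqOn_frobenius e he _ (Filter.eventually_cofinite.1 hev) _ _
    (continuous_character_toRepresentation_comp _ f hf)
    (continuous_character_toRepresentation_comp _ f' hf') ?_
  rintro d ⟨v, hv, 𝔓, h𝔓, hd⟩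
  have hv' := not_not.1 hv
  rw [character_toRepresentation_comp, character_toRepresentation_comp]
  refine framedRep_trace_eq_of_charpoly_eq _ _ ?_
  have hh : IsArithFrobAt (𝓞 K) (f d : absoluteGaloisGroup K) (g • 𝔓) := by
    rw [hfe]
    exact hd.conj g
  have hh' : IsArithFrobAt (𝓞 K) (f' d : absoluteGaloisGroup K) 𝔓 := by
    rw [hfe']
    exact hd
  refine charpoly_comp_transport_eq_of_companion ι ι₂ ρ t ht σ t' ht' σ' hv'.1 hv'.2
    (smul_mem_primesAbove h𝔓 g) h𝔓 hh hh' ?_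
  rw [hfe, hfe', charpoly_conj]

include ht ht' hmatch hmatch' in
/-- **`hiso`: `rᵢ^g ≅ rⱼ` on Mackey's subgroup.**  If `N ◁ Γ_K` is open, lies in `H` and `H'`,
and both transported companions are irreducible on `N`, then for every `g ∈ Γ_K` the conjugate
`rᵢ^g : d ↦ rᵢ(g d g⁻¹)` and the restriction of `rⱼ` to `H' ∩ g⁻¹ H g` are isomorphic: both are
irreducible (already on the image of `N`), hence semisimple, with equal characters
(`character_eq_of_companions`), so Brauer–Nesbitt applies
(`Representation.nonempty_equiv_of_character_eq_of_isSemisimple`). BLGGT 2014, proof of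
Thm. 5.5.1 (the step "`r_i^g|` and `r_j|` have the same trace, and are irreducible"). [folklore] -/
theorem nonempty_equiv_mackeyConjRep_of_companions (N : Subgroup (absoluteGaloisGroup K))
    [N.Normal] (hN : IsOpen (N : Set (absoluteGaloisGroup K))) (hNH : N ≤ H) (hNH' : N ≤ H')
    (hr : Representation.IsIrreducible
      ((FramedRep.toRepresentation (σ.comp t)).comp (Subgroup.inclusion hNH)))
    (hr' : Representation.IsIrreducible
      ((FramedRep.toRepresentation (σ'.comp t')).comp (Subgroup.inclusion hNH')))
    (g : absoluteGaloisGroup K) :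
    Nonempty (Representation.Equiv
      (mackeyConjRep H H' (FramedRep.toRepresentation (σ.comp t)) g)
      ((FramedRep.toRepresentation (σ'.comp t')).comp (mackeySubgroup H H' g).subtype)) := by
  have hH : IsOpen (H : Set (absoluteGaloisGroup K)) := Subgroup.isOpen_mono hNH hN
  have hH' : IsOpen (H' : Set (absoluteGaloisGroup K)) := Subgroup.isOpen_mono hNH' hN
  -- the inclusion `N → H' ∩ g⁻¹ H g` (cf. `Literature.RepresentationTheory.FiniteGroups.normalToMackey`)
  let ν : N →* mackeySubgroup H H' g :=
    { toFun := fun x => ⟨⟨x, hNH' x.2⟩, show g * (x : absoluteGaloisGroup K) * g⁻¹ ∈ H from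
        hNH (Subgroup.Normal.conj_mem inferInstance (x : absoluteGaloisGroup K) x.2 g)⟩
      map_one' := rfl
      map_mul' := fun _ _ => rfl }
  haveI : Representation.IsIrreducible
      ((FramedRep.toRepresentation (σ'.comp t')).comp (mackeySubgroup H H' g).subtype) :=
    Representation.isIrreducible_of_comp ν _ hr'
  haveI : (mackeyConjRep H H' (FramedRep.toRepresentation (σ.comp t)) g).IsIrreducible := by
    refine Representation.isIrreducible_of_comp ν _ ?_
    have : (mackeyConjRep H H' (FramedRep.toRepresentation (σ.comp t)) g).comp ν =
        ((FramedRep.toRepresentation (σ.comp t)).comp (Subgroup.inclusion hNH)).comp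
          (MulAut.conjNormal g : MulAut N).toMonoidHom := by
      refine MonoidHom.ext fun x => ?_
      exact congrArg (FramedRep.toRepresentation (σ.comp t)) (Subtype.ext rfl)
    rw [this]
    exact (Representation.isIrreducible_comp_iff_of_surjective _
      (MulAut.conjNormal g : MulAut N).surjective).2 hr
  exact Representation.nonempty_equiv_of_character_eq_of_isSemisimple _ _
    (character_eq_of_companions ι ι₂ ρ t ht σ hmatch t' ht' σ' hmatch'
      (fun d : mackeySubgroup H H' g => ((d : H') : absoluteGaloisGroup K))
      (isOpenEmbedding_subgroup_subgroup H' hH' _ (isOpen_mackeySubgroup H' hH g))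
      (mackeyConjHom H H' g) (continuous_mackeyConjHom H H' g) g (fun _ => rfl)
      (mackeySubgroup H H' g).subtype continuous_subtype_val (fun _ => rfl))

include ht ht' hmatch hmatch' in
/-- **`hr`: irreducibility on the normal layer.**  Let `N ≤ H` be open of finite index in `Γ_K`,
with `res(Γ_{E'}) = N` (`E' = L`, `c' = 1`, `H' = N`), let the companion `σ'` over `E'` be
irreducible and the companion `σ` over `E` semisimple.  Then the transport `rᵢ` of `σ` is
irreducible on `N`: `rᵢ|_N` is semisimple (Clifford's theorem and the relative Maschke theorem,
`isSemisimpleRepresentation_restrictSubgroup_of_finiteIndex`), has the same character as the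
(irreducible) transport of `σ'` (`character_eq_of_companions` with `g = 1`), so the two are
isomorphic by Brauer–Nesbitt. BLGGT 2014, proof of Thm. 5.5.1. [folklore] -/
theorem isIrreducible_comp_inclusion_of_companions
    (hc' : ∀ γ, γ ∈ (absGaloisRestrict K E').range ↔ c'⁻¹ * γ * c' ∈ H')
    (hc : ∀ γ, γ ∈ (absGaloisRestrict K E).range ↔ c⁻¹ * γ * c ∈ H)
    (hN : IsOpen (H' : Set (absoluteGaloisGroup K)))
    [H'.FiniteIndex] (hNH : H' ≤ H) (hirr : σ'.toRepresentation.IsIrreducible)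
    (hss : σ.toRepresentation.IsSemisimpleRepresentation) :
    Representation.IsIrreducible
      ((FramedRep.toRepresentation (σ.comp t)).comp (Subgroup.inclusion hNH)) := by
  -- the transport of `σ'` to `H' = N` is irreducible
  haveI hirr₂ : Representation.IsIrreducible
      ((FramedRep.toRepresentation (σ'.comp t')).comp (MonoidHom.id H')) := by
    have : (FramedRep.toRepresentation (σ'.comp t')).comp (MonoidHom.id H') =
        σ'.toRepresentation.comp t'.toMonoidHom := rfl
    rw [this]
    exact (Representation.isIrreducible_comp_iff_of_surjective _
      (transport_surjective hc' t' ht')).2 hirr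
  -- `rᵢ|_N` is semisimple
  haveI : Representation.IsSemisimpleRepresentation
      ((FramedRep.toRepresentation (σ.comp t)).comp (Subgroup.inclusion hNH)) := by
    have h1 : (FramedRep.toRepresentation (σ.comp t)).IsSemisimpleRepresentation := by
      have : (FramedRep.toRepresentation (σ.comp t)) =
          σ.toRepresentation.comp t.toMonoidHom := rfl
      rw [this]
      exact (FiniteGroups.Representation.isSemisimpleRepresentation_comp_iff_of_surjective _
        (transport_surjective hc t ht)).2 hss
    have h2 := Representation.isSemisimpleRepresentation_restrictSubgroup_of_finiteIndex
      (FramedRep.toRepresentation (σ.comp t)) (H'.subgroupOf H) h1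
    have : (FramedRep.toRepresentation (σ.comp t)).comp (Subgroup.inclusion hNH) =
        (Representation.restrictSubgroup (FramedRep.toRepresentation (σ.comp t)) (H'.subgroupOf H)).comp
          (Subgroup.subgroupOfEquivOfLe hNH).symm.toMonoidHom := rfl
    rw [this]
    exact (FiniteGroups.Representation.isSemisimpleRepresentation_comp_iff_of_surjective _
      (Subgroup.subgroupOfEquivOfLe hNH).symm.surjective).2 h2
  obtain ⟨e⟩ := Representation.nonempty_equiv_of_character_eq_of_isSemisimple _ _
    (character_eq_of_companions ι ι₂ ρ t ht σ hmatch t' ht' σ' hmatch'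
      (fun d : H' => (d : absoluteGaloisGroup K)) hN.isOpenEmbedding_subtypeVal
      (Subgroup.inclusion hNH) (continuous_induced_rng.2 continuous_subtype_val) 1
      (fun d => by simp) (MonoidHom.id H') continuous_id (fun _ => rfl))
  exact Representation.isIrreducible_of_equiv e.symm

end Rigidity

end Summit.Langlands.Langlands.Theorems.BrauerTaylorDescent

end
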